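import Literature.NumberTheory.ModularForms.ModularGroupAbelianization
import Literature.NumberTheory.ModularForms.SiegelModularGroupDegreeTwoCommutator
import Mathlib.GroupTheory.SpecificGroups.Cyclic
import HarnessLib

/-!
# The abelianizations of the Siegel modular groups: `Γ_1^{ab} ≅ ℤ/12`, `Γ_2^{ab} ≅ ℤ/2`, `Γ_n^{ab} = 1` (`n ≥ 3`)

I. Reiner, *Real linear characters of the symplectic modular group*, Proc. AMS **6** (1955) 987–990 (read in
*Selected Works* pp. 92–95): "`(Γ_2 : Γ_2') = 12`" (§2), "`(Γ_4 : Γ_4') = 2`" (§3), "`Γ'_{2n} = Γ_{2n}` for `n > 2`" (§3),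
with H. Klingen, *Introductory Lectures on Siegel Modular Forms* (1990), §4 p. 59: "for `n = 2` only one non-trivial
character exists, and none for `n > 2`". Lane `lit-hodgefound`, prover seat p25, row g33-#8: the three results of
g33-#1/#2/#3 (`SymplecticIntegerCommutatorSubgroup`, `SiegelModularGroupDegreeTwoCommutator`, `ModularGroupAbelianization`)
packaged as ISOMORPHISMS with explicit generators, together with the resulting classification of characters
(universal properties). Definitions (reviewed): the two `MulEquiv`s; no named fact.

## What is proved

* §1 `Γ_1 = SL(2, ℤ)` (namespace `Literature.NumberTheory.ModularForms.SL2Z`): `isCyclic_abelianization`;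
  **`abelianizationMulEquiv : Multiplicative (ZMod 12) ≃* SL(2, ℤ)^{ab}`** with `1 ↦ [T]`
  (`abelianizationMulEquiv_ofAdd_one`); **`abelianization_of_eq_of_T_zpow`** — the class of `γ = (a b; c d)` is
  `[T]^{e(γ)}`, `e(γ) = (1 - c²)(bd + 3(c-1)d + c + 3) + c(a + d - 3)` (so the abelianization map `SL(2, ℤ) → ℤ/12` is
  `γ ↦ e(γ) mod 12`: `abelianizationMulEquiv_symm_of`); **`existsUnique_hom_apply_T_eq`** — for every commutative
  group `A` and `a ∈ A` with `a¹² = 1` there is exactly one homomorphism `SL(2, ℤ) →* A` with `T ↦ a`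
  (`Hom(SL(2, ℤ), A) ≅ A[12]`).
* §2 `Γ_2 = Sp₄(ℤ)` (namespace `…SiegelModularGroupTwo`): `zpowers_of_unip_single_eq_top`, `isCyclic_abelianization`,
  **`abelianizationMulEquiv : Multiplicative (ZMod 2) ≃* Sp₄(ℤ)^{ab}`** with `1 ↦ [n(E₁₁)]`,
  `abelianization_of_eq` (`[M] = 1` or `[n(E₁₁)]` according to `v(M) = ±1`), **`existsUnique_hom_apply_unip_single_eq`**
  (`Hom(Sp₄(ℤ), A) ≅ A[2]`, `n(E₁₁) ↦ a`).
* §3 `Γ_n`, `n ≥ 3` (namespace `Literature.LinearAlgebra.Matrix.SymplecticMatrix`):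
  `card_abelianization_eq_one_of_three_le_card_int`.

## References

* [Reiner1955RealLinearCharacters] I. Reiner, Proc. Amer. Math. Soc. 6 (1955), 987–990, §§1–3.
* [Klingen1990] H. Klingen, *Introductory Lectures on Siegel Modular Forms*, CUP (1990), §4 p. 59.
-/

noncomputable section

open Matrix
open scoped MatrixGroups

namespace Literature.NumberTheory.ModularForms

/-! ### §1 `SL(2, ℤ)^{ab} ≅ ℤ/12`, generated by the class of `T`; the abelianization map is `γ ↦ e(γ) mod 12` -/

namespace SL2Z

open Literature.NumberTheory.EllipticCurves.ModularForms (etaSqExp cexp_pi_mul_I_div_six_pow_twelve)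

/-- Every element of `SL(2, ℤ)^{ab}` is a power of the class of `T`. [cite: Reiner1955RealLinearCharacters, §2] -/
theorem mem_zpowers_of_T (x : Abelianization SL(2, ℤ)) :
    x ∈ Subgroup.zpowers (Abelianization.of (ModularGroup.T : SL(2, ℤ))) := by
  rw [zpowers_of_T_eq_top]; exact Subgroup.mem_top x

/-- `SL(2, ℤ)^{ab}` is cyclic. [cite: Reiner1955RealLinearCharacters, §2] -/
theorem isCyclic_abelianization : IsCyclic (Abelianization SL(2, ℤ)) :=
  ⟨⟨Abelianization.of ModularGroup.T, mem_zpowers_of_T⟩⟩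

/-- **`SL(2, ℤ)^{ab} ≅ ℤ/12`**, the isomorphism sending `1 ∈ ℤ/12` to the class of `T = (1 1; 0 1)`
("`Γ_2 = ⋃_{m=0}^{11} T^m Γ_2'`, `(Γ_2 : Γ_2') = 12`"). [cite: Reiner1955RealLinearCharacters, §2] -/
def abelianizationMulEquiv : Multiplicative (ZMod 12) ≃* Abelianization SL(2, ℤ) :=
  zmodMulEquivOfGenerator mem_zpowers_of_T card_abelianization_eq_twelve

/-- `abelianizationMulEquiv 1 = [T]`. [cite: Reiner1955RealLinearCharacters, §2] -/
theorem abelianizationMulEquiv_ofAdd_one :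
    abelianizationMulEquiv (Multiplicative.ofAdd 1) = Abelianization.of ModularGroup.T :=
  zmodMulEquivOfGenerator_apply_ofAdd_one _ _

/-- `abelianizationMulEquiv (k mod 12) = [T]^k`. [cite: Reiner1955RealLinearCharacters, §2] -/
theorem abelianizationMulEquiv_ofAdd_intCast (k : ℤ) :
    abelianizationMulEquiv (Multiplicative.ofAdd (k : ZMod 12)) = Abelianization.of ModularGroup.T ^ k :=
  zmodMulEquivOfGenerator_apply_ofAdd_intCast _ _ k

/-- **The abelianization map in closed form**: the class of `γ = (a b; c d) ∈ SL(2, ℤ)` in `SL(2, ℤ)^{ab}` is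
`[T]^{e(γ)}` with `e(γ) = (1 - c²)(bd + 3(c-1)d + c + 3) + c(a + d - 3)` (the exponent of the character of `η²`:
`γ T^{-e(γ)}` lies in `ker χ_{η²} = Γ'`). [cite: Reiner1955RealLinearCharacters, §2] -/
theorem abelianization_of_eq_of_T_zpow (γ : SL(2, ℤ)) :
    Abelianization.of γ = Abelianization.of (ModularGroup.T : SL(2, ℤ)) ^ etaSqExp (γ 0 0) (γ 0 1) (γ 1 0) (γ 1 1) := by
  rw [← map_zpow, eq_comm, ← inv_mul_eq_one, ← map_inv, ← map_mul, ← MonoidHom.mem_ker, Abelianization.ker_of,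
    commutator_eq_ker_etaSqCharacter, MonoidHom.mem_ker, map_mul, map_inv, map_zpow, etaSqCharacter_T,
    etaSqCharacter_apply, ← Complex.exp_int_mul, mul_comm ((etaSqExp (γ 0 0) (γ 0 1) (γ 1 0) (γ 1 1) : ℤ) : ℂ),
    inv_mul_cancel₀ (Complex.exp_ne_zero _)]

/-- **`SL(2, ℤ) → ℤ/12` is `γ ↦ e(γ) mod 12`**: under `abelianizationMulEquiv`, the class of `γ` is
`e(γ) = (1 - c²)(bd + 3(c-1)d + c + 3) + c(a + d - 3)` modulo `12`. [cite: Reiner1955RealLinearCharacters, §2] -/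
theorem abelianizationMulEquiv_symm_of (γ : SL(2, ℤ)) :
    abelianizationMulEquiv.symm (Abelianization.of γ) =
      Multiplicative.ofAdd ((etaSqExp (γ 0 0) (γ 0 1) (γ 1 0) (γ 1 1) : ℤ) : ZMod 12) := by
  rw [abelianization_of_eq_of_T_zpow]
  exact zmodMulEquivOfGenerator_symm_apply_zpow _ _ _

/-- **`Hom(SL(2, ℤ), A) ≅ A[12]`**: for a commutative group `A` and `a ∈ A` with `a¹² = 1` there is exactly one
homomorphism `SL(2, ℤ) →* A` with `T ↦ a` (existence through the cyclic abelianization, uniqueness =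
`hom_ext_of_map_T_eq`). [cite: Reiner1955RealLinearCharacters, §2] -/
theorem existsUnique_hom_apply_T_eq {A : Type*} [CommGroup A] (a : A) (ha : a ^ 12 = 1) :
    ∃! φ : SL(2, ℤ) →* A, φ ModularGroup.T = a := by
  have hord : orderOf a ∣ orderOf (Abelianization.of (ModularGroup.T : SL(2, ℤ))) := by
    rw [orderOf_of_T]; exact orderOf_dvd_of_pow_eq_one ha
  refine ⟨(monoidHomOfForallMemZpowers mem_zpowers_of_T hord).comp Abelianization.of, ?_, fun φ hφ => ?_⟩
  · change monoidHomOfForallMemZpowers mem_zpowers_of_T hord (Abelianization.of ModularGroup.T) = a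
    exact monoidHomOfForallMemZpowers_apply_gen _ _
  · refine hom_ext_of_map_T_eq _ _ ?_
    rw [hφ]
    change a = monoidHomOfForallMemZpowers mem_zpowers_of_T hord (Abelianization.of ModularGroup.T)
    exact (monoidHomOfForallMemZpowers_apply_gen _ _).symm

end SL2Z

/-! ### §2 `Sp₄(ℤ)^{ab} ≅ ℤ/2`, generated by the class of `n(E₁₁)` -/

namespace SiegelModularGroupTwo

open Literature.RepresentationTheory.HeisenbergGroup.SymplecticMatrix (unip)
open Literature.LinearAlgebra.Matrix.SymplecticMatrix (isSymm_single_same hom_ext_of_map_unip_single_eq_int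
  map_unip_single_sq_eq_one_int)

/-- **`Sp₄(ℤ)^{ab}` is generated by the class of the translation `n(E₁₁)`** (a character of `Sp₄(ℤ)` is determined by
its value there, g33-#1). [cite: Reiner1955RealLinearCharacters, §3] [cite: Klingen1990, §4 p. 59] -/
theorem zpowers_of_unip_single_eq_top :
    Subgroup.zpowers (Abelianization.of (unip (single 0 0 (1 : ℤ)) (isSymm_single_same 0 1) :
      Matrix.symplecticGroup (Fin 2) ℤ)) = ⊤ := by
  set B := Subgroup.zpowers (Abelianization.of (unip (single 0 0 (1 : ℤ)) (isSymm_single_same 0 1) :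
      Matrix.symplecticGroup (Fin 2) ℤ))
  have hcomp : (QuotientGroup.mk' B).comp Abelianization.of = 1 :=
    hom_ext_of_map_unip_single_eq_int _ _ 0 (by
      rw [MonoidHom.comp_apply, MonoidHom.one_apply, QuotientGroup.mk'_apply, QuotientGroup.eq_one_iff]
      exact Subgroup.mem_zpowers _)
  rw [eq_top_iff]
  intro x _
  obtain ⟨g, rfl⟩ := QuotientGroup.mk_surjective x
  have hx := DFunLike.congr_fun hcomp g
  rw [MonoidHom.comp_apply, MonoidHom.one_apply, QuotientGroup.mk'_apply, QuotientGroup.eq_one_iff] at hx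
  exact hx

/-- Every element of `Sp₄(ℤ)^{ab}` is a power of `[n(E₁₁)]`. [cite: Reiner1955RealLinearCharacters, §3] -/
theorem mem_zpowers_of_unip_single (x : Abelianization (Matrix.symplecticGroup (Fin 2) ℤ)) :
    x ∈ Subgroup.zpowers (Abelianization.of (unip (single 0 0 (1 : ℤ)) (isSymm_single_same 0 1) :
      Matrix.symplecticGroup (Fin 2) ℤ)) := by
  rw [zpowers_of_unip_single_eq_top]; exact Subgroup.mem_top x

/-- `Sp₄(ℤ)^{ab}` is cyclic. [cite: Reiner1955RealLinearCharacters, §3] -/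
theorem isCyclic_abelianization : IsCyclic (Abelianization (Matrix.symplecticGroup (Fin 2) ℤ)) :=
  ⟨⟨_, mem_zpowers_of_unip_single⟩⟩

/-- **`Sp₄(ℤ)^{ab} ≅ ℤ/2`**, the isomorphism sending `1 ∈ ℤ/2` to the class of `n(E₁₁)` ("`(Γ_4 : Γ_4') = 2`").
[cite: Reiner1955RealLinearCharacters, §3] -/
def abelianizationMulEquiv : Multiplicative (ZMod 2) ≃* Abelianization (Matrix.symplecticGroup (Fin 2) ℤ) :=
  zmodMulEquivOfGenerator mem_zpowers_of_unip_single card_abelianization_eq_two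

/-- `abelianizationMulEquiv 1 = [n(E₁₁)]`. [cite: Reiner1955RealLinearCharacters, §3] -/
theorem abelianizationMulEquiv_ofAdd_one :
    abelianizationMulEquiv (Multiplicative.ofAdd 1) =
      Abelianization.of (unip (single 0 0 (1 : ℤ)) (isSymm_single_same 0 1)) :=
  zmodMulEquivOfGenerator_apply_ofAdd_one _ _

/-- The order of `[n(E₁₁)]` in `Sp₄(ℤ)^{ab}` is `2`. [cite: Reiner1955RealLinearCharacters, §3] -/
theorem orderOf_of_unip_single :
    orderOf (Abelianization.of (unip (single 0 0 (1 : ℤ)) (isSymm_single_same 0 1) :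
      Matrix.symplecticGroup (Fin 2) ℤ)) = 2 := by
  rw [← Nat.card_zpowers, zpowers_of_unip_single_eq_top, Subgroup.card_top]
  exact card_abelianization_eq_two

/-- **The abelianization map in closed form**: the class of `M ∈ Sp₄(ℤ)` is trivial iff `v(M) = 1`, and is
`[n(E₁₁)]` iff `v(M) = -1` (`v` = Klingen's theta character). [cite: Reiner1955RealLinearCharacters, §3]
[cite: Klingen1990, §9 p. 111] -/
theorem abelianization_of_eq (M : Matrix.symplecticGroup (Fin 2) ℤ) :
    Abelianization.of M = if thetaCharacter M = 1 then 1
      else Abelianization.of (unip (single 0 0 (1 : ℤ)) (isSymm_single_same 0 1)) := by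
  split_ifs with h
  · rwa [← MonoidHom.mem_ker, Abelianization.ker_of, mem_commutator_iff_thetaCharacter_eq_one]
  · -- `M n(E₁₁)⁻¹ ∈ Γ₂'` since `v(M) = -1 = v(n(E₁₁))`
    have hM : thetaCharacter M = -1 := (thetaCharacter_apply_eq M).resolve_left h
    have hn : thetaCharacter (unip (single 0 0 (1 : ℤ)) (isSymm_single_same 0 1)) = -1 := by
      rw [thetaCharacter_unip]; simp
    rw [← mul_inv_eq_one, ← map_inv, ← map_mul, ← MonoidHom.mem_ker, Abelianization.ker_of,
      mem_commutator_iff_thetaCharacter_eq_one, map_mul, map_inv, hM, hn]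
    norm_num

/-- **`Hom(Sp₄(ℤ), A) ≅ A[2]`**: for a commutative group `A` and `a ∈ A` with `a² = 1` there is exactly one
homomorphism `Sp₄(ℤ) →* A` with `n(E₁₁) ↦ a`. [cite: Reiner1955RealLinearCharacters, §1, §3] [cite: Klingen1990, §4 p. 59] -/
theorem existsUnique_hom_apply_unip_single_eq {A : Type*} [CommGroup A] (a : A) (ha : a ^ 2 = 1) :
    ∃! φ : Matrix.symplecticGroup (Fin 2) ℤ →* A, φ (unip (single 0 0 (1 : ℤ)) (isSymm_single_same 0 1)) = a := by
  have hord : orderOf a ∣ orderOf (Abelianization.of (unip (single 0 0 (1 : ℤ)) (isSymm_single_same 0 1) :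
      Matrix.symplecticGroup (Fin 2) ℤ)) := by
    rw [orderOf_of_unip_single]; exact orderOf_dvd_of_pow_eq_one ha
  refine ⟨(monoidHomOfForallMemZpowers mem_zpowers_of_unip_single hord).comp Abelianization.of, ?_,
    fun φ hφ => ?_⟩
  · change monoidHomOfForallMemZpowers mem_zpowers_of_unip_single hord (Abelianization.of _) = a
    exact monoidHomOfForallMemZpowers_apply_gen _ _
  · refine hom_ext_of_map_unip_single_eq_int _ _ 0 ?_
    rw [hφ]
    change a = monoidHomOfForallMemZpowers mem_zpowers_of_unip_single hord (Abelianization.of _)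
    exact (monoidHomOfForallMemZpowers_apply_gen _ _).symm

end SiegelModularGroupTwo

end Literature.NumberTheory.ModularForms

/-! ### §3 `Sp_{2n}(ℤ)^{ab} = 1` for `n ≥ 3` -/

namespace Literature.LinearAlgebra.Matrix.SymplecticMatrix

/-- **`|Sp_{2n}(ℤ)^{ab}| = 1` for `n ≥ 3`** ("`Γ'_{2n} = Γ_{2n}` for `n > 2`"). [cite: Reiner1955RealLinearCharacters, §3]
[cite: Klingen1990, §4 p. 59] -/
theorem card_abelianization_eq_one_of_three_le_card_int {l : Type*} [DecidableEq l] [Fintype l]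
    (h3 : 3 ≤ Fintype.card l) : Nat.card (Abelianization (Matrix.symplecticGroup l ℤ)) = 1 := by
  haveI := subsingleton_abelianization_of_three_le_card_int h3
  exact Nat.card_unique

end Literature.LinearAlgebra.Matrix.SymplecticMatrix

end
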